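/-
Copyright (c) 2026 the pub-hodgecm-mathlib formalisation cell (harness21).  Prover seat hodgecm-mathlib-K2Liu-p10 (g5), Track B «K2-LIT»,
#184♮ = hLiu418 = `stmt-HodgeConjecture-24832`; (σ) endgame organ, socket σ-7b: THE SOCKET `hSiegS` OF THE FACE FOR THE SMALL-SIDE SECTION `B := sectionB`.
-/
import Summits.HodgeConjecture.HodgeConjecture.Theorems.K2LiuA7ValueSliceGeometry                -- ★∕📤 σ-7a (hq0, pins, frame, `hG`; brings ★ σ-2 `sectionB`, `thetaLoc`)
import Summits.HodgeConjecture.HodgeConjecture.Theorems.K2LiuA7ValueSocketSiegS                  -- ★ σ-5 p860953 (`isLocalSiegelSection_of_levi_unip`, `levi_law_shift`)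
import Summits.HodgeConjecture.HodgeConjecture.Theorems.K2LiuA7ValueSocketLeviResidue            -- ★ σ-6 p861050 (`conjInvChar_localComponent_pow_eq`)
import Summits.HodgeConjecture.HodgeConjecture.Theorems.K2LiuLeviCharacterFromSiegelLaw          -- ★ (L3-a) p860731 (`coe_cM_eq_localSiegelCharacter`)
import Summits.HodgeConjecture.HodgeConjecture.Theorems.K2LiuKRFrameLeviSlice                    -- ★ S-2c (b) p860871 (`krFrameTw_leviAct_inv_slice_mulVec`)
import Summits.HodgeConjecture.HodgeConjecture.Theorems.K2LiuKRFrameLeviJacobian                 -- ★ S-2c (c) p860917 (`coe_inv_distribHaarChar_det_leviAct_inv`)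
import Summits.HodgeConjecture.HodgeConjecture.Theorems.K2LiuA7ValueInstanceLeviLaw              -- ★ I-3a (`exists_character_toRep_levi`, `continuous_leviRhoLoc`)
import Summits.HodgeConjecture.HodgeConjecture.Theorems.K2LiuA7ValueInstanceSectionMapValues     -- ★ (`sectionMapLoc_apply_one`; brings ★ I-4a `sectionMapLoc`, `sectionMapLoc_toRep`)
import Summits.HodgeConjecture.HodgeConjecture.Theorems.K2LiuLeviDeltaDecomposition              -- ★ K2Liu-p09 (`exists_leviDeltaLoc_mul_unipDeltaLocal`; brings ★ ASK 1 `K2LiuSiegelBlockDAbsDetDelta`)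
import Literature.NumberTheory.Automorphic.LocalPiSchwartzBruhatFourier                         -- ★ `piPrimePowBall`, `indicator_piPrimePowBall_mem_schwartzBruhat`
import HarnessLib

/-!
# Crux `HLiu418`, (σ) endgame, σ-7b: `hSiegS` — THE SMALL-SIDE SECTION `B := sectionB` IS A SIEGEL SECTION OF `I_v(−½, χ_v)`

Cell `hodgecm-mathlib`, crux item hLiu418 = `stmt-HodgeConjecture-24832`, route of record `HCCMUnconditional`; squad K2 ∕ K2Liu, prover K2Liu-p10 (g5).
THEOREMS ONLY (no definition, no instance, no notation, no named fact, no `sorry`); lane `--supports stmt-HodgeConjecture-24832 --as helper`.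

The face ★ I-4b `faceA4R_two_of_record(_v2)` takes the small side `B, hB, hSiegS` BY VALUE.  With ★ σ-2 `B := sectionB … P μX ω` (`hB := sectionB_mul`), this file supplies
**`hSiegS`** at the instance of record (`H_v = U(𝔻)(L⁺_v) = U(2,2)`, `V′ = (L³, diag dV′)`, Weil datum `(χ, 𝔪, 𝓕)` of the big datum, Δ-intertwiner `Γ`;
`ω u := ω^Δ(s^Δ_B u)`, `s^Δ_B := mpTransportLoc Γ ∘ s_𝔻 ∘ tensorEmbLoc` exactly as in the face):

* §1 **`sectionB_leviDeltaLoc_mul`** — THE LEVI LAW `B Φ (a · h) = χ_v(det_Δ a)|det_Δ a|^{−½+1} · B Φ h` for `a ∈ M_Δ`: ★ S-2b `krSection_levi_mul` fed with the Levi law of `ω`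
  (★ I-3a `exists_character_toRep_levi`), the slice letter `hS0` (★ S-2c (b) + ★∕📤 σ-7a `val_inv_leviBlkDHom`), the Jacobian `mod(det D_a)⁻¹ = Π_w ‖det D(a)_w‖`
  (★ S-2c (c)) times `|det_Δ a|_v = 1` (★ K2Liu-p09 ASK 1 `prod_norm_det_blkD_mul_absDetDelta_of_blkC`), the identification `χ_M = χ_v(det_Δ)|det_Δ|^{½+1}`
  (★ (L3-a) at `𝒜 := sectionMapLoc`, ★ I-4a `sectionMapLoc_toRep`, ★ `sectionMapLoc_apply_one`) and the shift `½ ↦ −½` (★ σ-5 `levi_law_shift`).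
* §2 **`sectionB_nDeltaLoc_mul`** — `N_Δ`-INVARIANCE `B Φ (nΔ η · h) = B Φ h` from V8e's per-pin law `hN` BY VALUE (the SAME socket term the face consumes, with `nΔ := nDeltaLoc`,
  `q := qHerm`, `ψ := adeleAddCharAt`; K2Liu-p02's letter (C) pays it) and `hq0` (★∕📤 σ-7a): ★ S-2b `krSection_unip_mul`; all of `N_Δ` by ★∕📤 σ-7a `exists_nDeltaLoc_eq_of_mem_unipDeltaLocal`.
* §3 **`isLocalSiegelSection_sectionB`** — THE SOCKET: `∀ Φ, IsLocalSiegelSection … χ_v (−½) (B Φ)` (★ σ-5 fold, ★ K2Liu-p09 `exists_leviDeltaLoc_mul_unipDeltaLocal` = `hdecomp`), and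
  **`isLocalSiegelSection_sectionB_conjInvChar`** — the same for `χ′_v := conjInvChar c v χ_v` under `hχs : IsSplittingChar L 1 χ` (★ σ-6: `χ′_v = χ_v`).
Residual by-value data: the Witt frame `(P, W, hW, hPJ)` (★∕📤 σ-7a `exists_sliceFrame` supplies it at a non-split `v`), a Haar measure `μX` on `L⁺_v^{2+2}`, and `hN`.

HONEST LABEL: HC_CM is proved only modulo the 7 printed citations (2 remaining named inputs: hLiu418 = stmt-HodgeConjecture-24832, h413 = stmt-HodgeConjecture-24833)
until rung 0 closes; helper, closes no item.
References: [KudlaRallis1994] §1; [Kudla1994] §3 Thm. 3.1; [HarrisKudlaSweet1996] §1 (1.11), (1.15)–(1.16), §4; [GanQiuTakeda2014] §2.7–2.8.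
-/

set_option autoImplicit false
set_option linter.dupNamespace false -- the mandated namespace repeats `HodgeConjecture.HodgeConjecture`

noncomputable section

open scoped Matrix NNReal
open NumberField IsDedekindDomain MeasureTheory Matrix
open Literature.NumberTheory.GaloisRepresentations
open Literature.NumberTheory.Automorphic Literature.NumberTheory.Automorphic.UnitaryGroup
open Literature.NumberTheory.GelbartRogawski1991 Literature.NumberTheory.GelbartRogawski1991.GRConstruction
open Literature.NumberTheory.GelbartRogawski1991.UnitaryDualPair
open Literature.NumberTheory.GelbartRogawski1991.UnitaryDualPair.LocalSplitting
open Literature.NumberTheory.GelbartRogawski1991.AdaptedBlocks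
open Literature.NumberTheory.K2Lit.SiegelDoubled Literature.NumberTheory.K2Lit.LocalSiegelDoubled
open Literature.RepresentationTheory.HeisenbergGroup
open Literature.RepresentationTheory.HarrisKudlaSweet1996
open Summit.HodgeConjecture.HodgeConjecture.Cruxes.HLiu418.K2LiuDoublingSchrodingerModelDefs
open Summit.HodgeConjecture.HodgeConjecture.Cruxes.HLiu418.K2LiuDoublingModelComparison
open Summit.HodgeConjecture.HodgeConjecture.Cruxes.HLiu418.K2LiuLocalSWSectionDefs
open Summit.HodgeConjecture.HodgeConjecture.Cruxes.HLiu418.K2LiuSWSectionPlaceFactorisation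
open Summit.HodgeConjecture.HodgeConjecture.Cruxes.HLiu418.K2LiuSWSectionTensorPlaceFactorisation
open Summit.HodgeConjecture.HodgeConjecture.Cruxes.HLiu418.K2LiuDeltaModelRealFrame
open Summit.HodgeConjecture.HodgeConjecture.Cruxes.HLiu418.K2LiuA7ValueInstanceDefs
open Summit.HodgeConjecture.HodgeConjecture.Cruxes.HLiu418.K2LiuA7ValueInstanceLeviLaw
open Summit.HodgeConjecture.HodgeConjecture.Cruxes.HLiu418.K2LiuA7ValueInstanceSectionMap
open Summit.HodgeConjecture.HodgeConjecture.Cruxes.HLiu418.K2LiuA7ValueInstanceSectionMapValues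
open Summit.HodgeConjecture.HodgeConjecture.Cruxes.HLiu418.K2LiuA7ValueUnipotentPinsHerm
open Summit.HodgeConjecture.HodgeConjecture.Cruxes.HLiu418.K2LiuA7ValueUnipotentPinsN
open Summit.HodgeConjecture.HodgeConjecture.Cruxes.HLiu418.K2LiuKRFrameDefs
open Summit.HodgeConjecture.HodgeConjecture.Cruxes.HLiu418.K2LiuKRFrameLeviSlice
open Summit.HodgeConjecture.HodgeConjecture.Cruxes.HLiu418.K2LiuKRFrameLeviJacobian
open Summit.HodgeConjecture.HodgeConjecture.Cruxes.HLiu418.K2LiuKRSectionDefs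
open Summit.HodgeConjecture.HodgeConjecture.Cruxes.HLiu418.K2LiuKRFrameInstanceDefs
open Summit.HodgeConjecture.HodgeConjecture.Cruxes.HLiu418.K2LiuLocalSiegel
open Summit.HodgeConjecture.HodgeConjecture.Cruxes.HLiu418.K2LiuA7ValueSocketSiegS
open Summit.HodgeConjecture.HodgeConjecture.Cruxes.HLiu418.K2LiuA7ValueSocketChi
open Summit.HodgeConjecture.HodgeConjecture.Cruxes.HLiu418.K2LiuA7ValueSocketLeviResidue
open Summit.HodgeConjecture.HodgeConjecture.Cruxes.HLiu418.K2LiuLeviCharacterFromSiegelLaw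
open Summit.HodgeConjecture.HodgeConjecture.Cruxes.HLiu418.K2LiuSiegelBlockDAbsDetDelta
open Summit.HodgeConjecture.HodgeConjecture.Cruxes.HLiu418.K2LiuLeviDeltaDecomposition
open Summit.HodgeConjecture.HodgeConjecture.Cruxes.HLiu418.K2LiuA7ValueSliceGeometry

namespace Summit.HodgeConjecture.HodgeConjecture.Cruxes.HLiu418.K2LiuA7ValueSocketSmallSide

/-- a representation pulled back along a homomorphism is multiplicative: `T(S(g u)) Ψ = T(S g) (T(S u) Ψ)` (the `hω` of ★ S-2b for `ω := ω^Δ ∘ s^Δ_B`). [folklore] -/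
theorem rep_comp_mul_apply {k : Type*} [CommSemiring k] {H Mp V : Type*} [Monoid H] [Monoid Mp] [AddCommMonoid V] [Module k V]
    (T : Mp →* (V →ₗ[k] V)) (S : H →* Mp) (g u : H) (Ψ : V) : T (S (g * u)) Ψ = T (S g) (T (S u) Ψ) := by
  rw [map_mul, map_mul, Module.End.mul_apply]

variable (L : Type) [Field L] [NumberField L] [IsCMField L] [Algebra.IsQuadraticExtension (Fp L) L]
variable {N M : ℕ} (e : Fin N × Fin M ≃ Fin 2)
  (dV : Fin N → L) (hdV : ∀ i, IsCMField.complexConj L (dV i) = dV i) (hdV0 : ∀ i, dV i ≠ 0)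
  (dW : Fin M → L) (hdW : ∀ i, IsCMField.complexConj L (dW i) = dW i) (hdW0 : ∀ i, dW i ≠ 0)
variable {M' n' : ℕ} (eW : Fin M × Fin 3 ≃ Fin M') (e' : Fin N × Fin M' ≃ Fin n')
  (dV' : Fin 3 → L) (hdV' : ∀ k, IsCMField.complexConj L (dV' k) = dV' k) (hdV'0 : ∀ k, dV' k ≠ 0) (hM₂ : (3 : ℕ) ≠ 0)
variable (χ : HeckeCharacter L) (𝔪 : ∀ v, PlaceMeasure L v)
  (𝓕 : FinLocalFamily L e' dV hdV hdV0 (tensorFrame L dW eW dV') (tensorFrame_real L dW hdW eW dV' hdV') (tensorFrame_ne_zero L dW eW dV' hdW0 hdV'0) χ 𝔪)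
  (v : HeightOneSpectrum (𝓞 (Fp L)))
  [MeasurableSpace (Fin n' → v.adicCompletion (Fp L))] [BorelSpace (Fin n' → v.adicCompletion (Fp L))]
  (μ : Measure (Fin n' → v.adicCompletion (Fp L))) [μ.IsAddHaarMeasure]
  (Γ : SchwartzBruhat (Fin (n' + n') → v.adicCompletion (Fp L)) ≃ₗ[ℂ] SchwartzBruhat (Fin (n' + n') → v.adicCompletion (Fp L)))
  (hΓ : IsDeltaIntertwiner L e' dV hdV (tensorFrame L dW eW dV') (tensorFrame_real L dW hdW eW dV' hdV') v Γ)
  (hΓ0 : ∀ Ψ : SchwartzBruhat (Fin (n' + n') → v.adicCompletion (Fp L)),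
    ((Γ Ψ : SchwartzBruhat (Fin (n' + n') → v.adicCompletion (Fp L))) : (Fin (n' + n') → v.adicCompletion (Fp L)) → ℂ) 0 =
      diagIntegral (GRConstruction.e₂ (n := n')) μ Ψ)
  (hs₀ : (1 / 2 : ℂ) = (((3 : ℕ) : ℂ) - ((2 : ℕ) : ℂ)) / 2)
  -- the small-side frame data (★∕📤 σ-7a `exists_sliceFrame` supplies `P, W, hW, hPJ` at a non-split `v`) and the slice Haar measure
  [MeasurableSpace (v.adicCompletion (Fp L))] [BorelSpace (v.adicCompletion (Fp L))] [SecondCountableTopology (v.adicCompletion (Fp L))]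
  (P : GL (Fin 3) (LocalRing L v)) (W : Matrix (Fin 3) (Fin 3) (LocalRing L v)) (hW : W 0 0 = 0)
  (hPJ : (P.val.map (conjLocal L (IsCMField.complexConj L) v : LocalRing L v →+* LocalRing L v))ᵀ * W * P.val =
    (adelicForm L 3 (Matrix.diagonal dV')).map (adeleToLocal L v))
  (μX : Measure (Fin (2 + 2) → v.adicCompletion (Fp L))) [μX.IsAddHaarMeasure]

/-! ## §1 The Levi law of `B := sectionB` -/

set_option maxHeartbeats 3200000 in -- 2× ★ I-4b `faceA4R_two_of_record` (the record telescope `finSplittings … χ 𝔪 𝓕` is read twice: Levi law + `χ_M` identification)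
set_option maxRecDepth 4096 in
include hdV'0 hM₂ μ hΓ0 hs₀ in
/-- **THE LEVI LAW OF THE SMALL-SIDE SECTION**: for `a ∈ M_Δ`, `B Φ (a · h) = χ_v(det_Δ a)·|det_Δ a|_v^{(½ − 1) + 1} · B Φ h`, `B := sectionB … P μX ω`, `ω := ω^Δ ∘ s^Δ_B`
(`χ_v := ((χ³)_w)_w`).  [cite: KudlaRallis1994, §1] [cite: Kudla1994, §3 Thm. 3.1] [cite: HarrisKudlaSweet1996, §1 (1.15)–(1.16)] -/
theorem sectionB_leviDeltaLoc_mul (a : ↥(leviDeltaLoc L e dV hdV dW hdW v)) (Φ : SchwartzBruhat (Fin (n' + n') → v.adicCompletion (Fp L)))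
    (h : UnitaryGroup.localPi L (IsCMField.complexConj L) (2 + 2) (hermD L e dV hdV dW hdW) v) :
    sectionB L e dV hdV hdV0 dW hdW hdW0 eW e' v P μX
        (fun u => MpPsi.toRep (localSchrodingerDelta L e' dV hdV (tensorFrame L dW eW dV') (tensorFrame_real L dW hdW eW dV' hdV') v)
          (((mpTransportLoc L e' dV hdV (tensorFrame L dW eW dV') (tensorFrame_real L dW hdW eW dV' hdV') v Γ hΓ).toMonoidHom.comp
            (((finSplittings L e' dV hdV hdV0 (tensorFrame L dW eW dV') (tensorFrame_real L dW hdW eW dV' hdV') (tensorFrame_ne_zero L dW eW dV' hdW0 hdV'0) χ 𝔪 𝓕).s v).comp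
              (tensorEmbLoc L e dV hdV dW hdW eW e' dV' hdV' v))) u)) Φ
        ((a : UnitaryGroup.localPi L (IsCMField.complexConj L) (2 + 2) (hermD L e dV hdV dW hdW) v) * h) =
      localSiegelCharacter (Fp L) L (IsCMField.complexConj L) v 2 (fun w : PlacesOver L v => (χ ^ 3).localComponent w.1) (1 / 2 - 1)
          (a : UnitaryGroup.localPi L (IsCMField.complexConj L) (2 + 2) (hermD L e dV hdV dW hdW) v) *
        sectionB L e dV hdV hdV0 dW hdW hdW0 eW e' v P μX
          (fun u => MpPsi.toRep (localSchrodingerDelta L e' dV hdV (tensorFrame L dW eW dV') (tensorFrame_real L dW hdW eW dV' hdV') v)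
            (((mpTransportLoc L e' dV hdV (tensorFrame L dW eW dV') (tensorFrame_real L dW hdW eW dV' hdV') v Γ hΓ).toMonoidHom.comp
              (((finSplittings L e' dV hdV hdV0 (tensorFrame L dW eW dV') (tensorFrame_real L dW hdW eW dV' hdV') (tensorFrame_ne_zero L dW eW dV' hdW0 hdV'0) χ 𝔪 𝓕).s v).comp
                (tensorEmbLoc L e dV hdV dW hdW eW e' dV' hdV' v))) u)) Φ h := by
  -- the Levi law of `ω` on `M_Δ` (★ I-3a)
  have hsproj := fun g => (finSplittings L e' dV hdV hdV0 (tensorFrame L dW eW dV') (tensorFrame_real L dW hdW eW dV' hdV') (tensorFrame_ne_zero L dW eW dV' hdW0 hdV'0) χ 𝔪 𝓕).proj_s v g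
  obtain ⟨cM, hM⟩ := exists_character_toRep_levi L e dV hdV hdV0 dW hdW hdW0 eW e' dV' hdV' hdV'0 v Γ hΓ
    ((finSplittings L e' dV hdV hdV0 (tensorFrame L dW eW dV') (tensorFrame_real L dW hdW eW dV' hdV') (tensorFrame_ne_zero L dW eW dV' hdW0 hdV'0) χ 𝔪 𝓕).s v) hsproj
  -- the same law read for `ω u := ω^Δ(s^Δ_B u)` and `mΔ := M_Δ.subtype` (one definitional conversion, reused below)
  have hM' : ∀ (a : ↥(leviDeltaLoc L e dV hdV dW hdW v)) (Ψ : SchwartzBruhat (Fin (n' + n') → v.adicCompletion (Fp L))),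
      (fun u => MpPsi.toRep (localSchrodingerDelta L e' dV hdV (tensorFrame L dW eW dV') (tensorFrame_real L dW hdW eW dV' hdV') v)
          (((mpTransportLoc L e' dV hdV (tensorFrame L dW eW dV') (tensorFrame_real L dW hdW eW dV' hdV') v Γ hΓ).toMonoidHom.comp
            (((finSplittings L e' dV hdV hdV0 (tensorFrame L dW eW dV') (tensorFrame_real L dW hdW eW dV' hdV') (tensorFrame_ne_zero L dW eW dV' hdW0 hdV'0) χ 𝔪 𝓕).s v).comp
              (tensorEmbLoc L e dV hdV dW hdW eW e' dV' hdV' v))) u))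
          ((leviDeltaLoc L e dV hdV dW hdW v).subtype a) Ψ =
        (cM a : ℂ) • leviEquivSB (leviRhoLoc L (complexConj_imagUnit L) (imagUnit_ne_zero L) e dV hdV dW hdW eW e' dV' hdV' v a)
          (continuous_leviRhoLoc L e dV hdV dW hdW eW e' dV' hdV' v a).1 (continuous_leviRhoLoc L e dV hdV dW hdW eW e' dV' hdV' v a).2 Ψ :=
    fun a Ψ => hM a Ψ
  -- `ω := ω^Δ ∘ s^Δ_B` is multiplicative
  have hω := fun (g u : UnitaryGroup.localPi L (IsCMField.complexConj L) (2 + 2) (hermD L e dV hdV dW hdW) v) (Ψ : SchwartzBruhat (Fin (n' + n') → v.adicCompletion (Fp L))) =>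
    rep_comp_mul_apply (MpPsi.toRep (localSchrodingerDelta L e' dV hdV (tensorFrame L dW eW dV') (tensorFrame_real L dW hdW eW dV' hdV') v))
      ((mpTransportLoc L e' dV hdV (tensorFrame L dW eW dV') (tensorFrame_real L dW hdW eW dV' hdV') v Γ hΓ).toMonoidHom.comp
        (((finSplittings L e' dV hdV hdV0 (tensorFrame L dW eW dV') (tensorFrame_real L dW hdW eW dV' hdV') (tensorFrame_ne_zero L dW eW dV' hdW0 hdV'0) χ 𝔪 𝓕).s v).comp
          (tensorEmbLoc L e dV hdV dW hdW eW e' dV' hdV' v))) g u Ψ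
  -- the `D`-block of `a` in the small datum and the slice matrix `D_a := [leviAct_2 (D(a)⁻¹)]`
  let Dsm : ↥(leviDeltaLoc L e dV hdV dW hdW v) → GL (Fin 2) (LocalRing L v) := fun a =>
    blkDGL (Fp L) L (IsCMField.complexConj L) v 2 (a : UnitaryGroup.localPi L (IsCMField.complexConj L) (2 + 2) (hermD L e dV hdV dW hdW) v)
      (blkC_coe_leviDeltaLoc L e dV hdV dW hdW v a)
  let D : ↥(leviDeltaLoc L e dV hdV dW hdW v) → Matrix (Fin (2 + 2)) (Fin (2 + 2)) (v.adicCompletion (Fp L)) := fun a =>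
    LinearMap.toMatrix' ((leviAct (Fp L) L (IsCMField.complexConj L) (complexConj_imagUnit L) (imagUnit_ne_zero L) v 2 (Dsm a)⁻¹ :
      (Fin (2 + 2) → v.adicCompletion (Fp L)) ≃ₗ[v.adicCompletion (Fp L)] (Fin (2 + 2) → v.adicCompletion (Fp L))) :
        (Fin (2 + 2) → v.adicCompletion (Fp L)) →ₗ[v.adicCompletion (Fp L)] (Fin (2 + 2) → v.adicCompletion (Fp L)))
  have hD : ∀ a, (D a).det ≠ 0 := fun a => by
    simp only [D]
    rw [LinearMap.det_toMatrix', ← LinearEquiv.coe_det]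
    exact Units.ne_zero _
  -- the slice letter `hS0` (★ S-2c (b) with the `hG` letter of σ-7a)
  have hS0 : ∀ (a : ↥(leviDeltaLoc L e dV hdV dW hdW v)) (t : Fin (2 + 2) → v.adicCompletion (Fp L)),
      thetaLoc L e dV hdV hdV0 dW hdW hdW0 eW e' v P
          ((leviRhoLoc L (complexConj_imagUnit L) (imagUnit_ne_zero L) e dV hdV dW hdW eW e' dV' hdV' v a).symm
            ((thetaLoc L e dV hdV hdV0 dW hdW hdW0 eW e' v P).symm
              (Sum.elim (Sum.elim (0 : Fin (2 + 2) → v.adicCompletion (Fp L)) (0 : Fin (2 + 2) → v.adicCompletion (Fp L))) t))) =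
        Sum.elim (Sum.elim (0 : Fin (2 + 2) → v.adicCompletion (Fp L)) (0 : Fin (2 + 2) → v.adicCompletion (Fp L))) (D a *ᵥ t) := fun a t => by
    rw [leviRhoLoc_apply, thetaLoc_eq]
    exact krFrameTw_leviAct_inv_slice_mulVec (Fp L) L (IsCMField.complexConj L) (complexConj_imagUnit L) (imagUnit_ne_zero L) v 2 (epsV e eW e') P
      (twistLoc L e dV hdV hdV0 dW hdW hdW0 v) (leviBlkDHom L e dV hdV dW hdW eW e' dV' hdV' v a) (Dsm a)
      (val_inv_leviBlkDHom L e dV hdV dW hdW eW e' dV' hdV' v a) t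
  -- STEP 1: the generic Levi law of the Kudla–Rallis section
  have h1 := fun (a : ↥(leviDeltaLoc L e dV hdV dW hdW v)) (h : UnitaryGroup.localPi L (IsCMField.complexConj L) (2 + 2) (hermD L e dV hdV dW hdW) v) =>
    krSection_levi_mul (thetaLoc L e dV hdV hdV0 dW hdW hdW0 eW e' v P) μX
      (fun u => MpPsi.toRep (localSchrodingerDelta L e' dV hdV (tensorFrame L dW eW dV') (tensorFrame_real L dW hdW eW dV' hdV') v)
        (((mpTransportLoc L e' dV hdV (tensorFrame L dW eW dV') (tensorFrame_real L dW hdW eW dV' hdV') v Γ hΓ).toMonoidHom.comp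
          (((finSplittings L e' dV hdV hdV0 (tensorFrame L dW eW dV') (tensorFrame_real L dW hdW eW dV' hdV') (tensorFrame_ne_zero L dW eW dV' hdW0 hdV'0) χ 𝔪 𝓕).s v).comp
            (tensorEmbLoc L e dV hdV dW hdW eW e' dV' hdV' v))) u))
      hω (R := v.adicCompletion (Fp L))
      (fun a : ↥(leviDeltaLoc L e dV hdV dW hdW v) => (a : UnitaryGroup.localPi L (IsCMField.complexConj L) (2 + 2) (hermD L e dV hdV dW hdW) v))
      (fun a => leviRhoLoc L (complexConj_imagUnit L) (imagUnit_ne_zero L) e dV hdV dW hdW eW e' dV' hdV' v a)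
      (fun a => (continuous_leviRhoLoc L e dV hdV dW hdW eW e' dV' hdV' v a).1) (fun a => (continuous_leviRhoLoc L e dV hdV dW hdW eW e' dV' hdV' v a).2)
      (fun a => (cM a : ℂ)) hM' D hD hS0 Φ a h
  -- STEP 2: `χ_M = localSiegelCharacter χ_v ½` (★ (L3-a) at `𝒜 := sectionMapLoc`)
  have hΦ : ∃ Φ₀ : SchwartzBruhat (Fin (n' + n') → v.adicCompletion (Fp L)), (Φ₀ : (Fin (n' + n') → v.adicCompletion (Fp L)) → ℂ) 0 ≠ 0 :=
    ⟨⟨(piPrimePowBall (v.adicCompletion (Fp L)) (Fin (n' + n')) 0).indicator fun _ => (1 : ℂ), indicator_piPrimePowBall_mem_schwartzBruhat 0 1⟩, by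
      show ((piPrimePowBall (v.adicCompletion (Fp L)) (Fin (n' + n')) 0).indicator fun _ => (1 : ℂ)) 0 ≠ 0
      rw [Set.indicator_of_mem (zero_mem_piPrimePowBall (F := v.adicCompletion (Fp L)) (ι := Fin (n' + n')) 0)]
      exact one_ne_zero⟩
  have hcM := coe_cM_eq_localSiegelCharacter (Fp L) L (IsCMField.complexConj L) (complexConj_imagUnit L) (imagUnit_ne_zero L) (imagUnit_mul_self L) v 2
    (gramR_isSymm L e dV hdV dW hdW) (hermD_eq_map_gramD L e dV hdV dW hdW) (fun w : PlacesOver L v => (χ ^ 3).localComponent w.1) (1 / 2)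
    (fun u => MpPsi.toRep (localSchrodingerDelta L e' dV hdV (tensorFrame L dW eW dV') (tensorFrame_real L dW hdW eW dV' hdV') v)
      (((mpTransportLoc L e' dV hdV (tensorFrame L dW eW dV') (tensorFrame_real L dW hdW eW dV' hdV') v Γ hΓ).toMonoidHom.comp
        (((finSplittings L e' dV hdV hdV0 (tensorFrame L dW eW dV') (tensorFrame_real L dW hdW eW dV' hdV') (tensorFrame_ne_zero L dW eW dV' hdW0 hdV'0) χ 𝔪 𝓕).s v).comp
          (tensorEmbLoc L e dV hdV dW hdW eW e' dV' hdV' v))) u))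
    (sectionMapLoc L e dV hdV hdV0 dW hdW hdW0 eW e' dV' hdV' hdV'0 hM₂ χ 𝔪 𝓕 v μ Γ hΓ hΓ0 (1 / 2) hs₀)
    (sectionMapLoc_toRep L e dV hdV hdV0 dW hdW hdW0 eW e' dV' hdV' hdV'0 hM₂ χ 𝔪 𝓕 v μ Γ hΓ hΓ0 (1 / 2) hs₀)
    (κ := 1) one_ne_zero
    (fun Ψ => by rw [one_mul]; exact sectionMapLoc_apply_one L e dV hdV hdV0 dW hdW hdW0 eW e' dV' hdV' hdV'0 hM₂ χ 𝔪 𝓕 v μ Γ hΓ hΓ0 (1 / 2) hs₀ Ψ)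
    hΦ (leviDeltaLoc L e dV hdV dW hdW v).subtype
    (fun a => isSiegelDelta_of_mem_leviDeltaLoc L e dV hdV dW hdW v (complexConj_imagUnit L) (imagUnit_ne_zero L) (imagUnit_mul_self L) (gramR_isSymm L e dV hdV dW hdW)
      (hermD_eq_map_gramD L e dV hdV dW hdW) a.2)
    (leviRhoLoc L (complexConj_imagUnit L) (imagUnit_ne_zero L) e dV hdV dW hdW eW e' dV' hdV' v)
    (fun a => (continuous_leviRhoLoc L e dV hdV dW hdW eW e' dV' hdV' v a).1) (fun a => (continuous_leviRhoLoc L e dV hdV dW hdW eW e' dV' hdV' v a).2)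
    cM hM'
  -- STEP 3: the Jacobian `mod(det D_a)⁻¹ · |det_Δ a|_v = 1` (★ S-2c (c) + ★ ASK 1)
  have hr : ∀ a : ↥(leviDeltaLoc L e dV hdV dW hdW v),
      (((distribHaarChar (v.adicCompletion (Fp L)) (Units.mk0 (D a).det (hD a)))⁻¹ : ℝ≥0) : ℝ) *
        absDetDelta (Fp L) L (IsCMField.complexConj L) v 2 (a : UnitaryGroup.localPi L (IsCMField.complexConj L) (2 + 2) (hermD L e dV hdV dW hdW) v) = 1 := fun a => by
    simp only [D]
    rw [coe_inv_distribHaarChar_det_leviAct_inv (Fp L) L (IsCMField.complexConj L) (complexConj_imagUnit L) (imagUnit_ne_zero L) v 2 (Dsm a)]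
    simp only [Dsm, val_blkDGL]
    exact prod_norm_det_blkD_mul_absDetDelta_of_blkC (Fp L) L (IsCMField.complexConj L) v 2 (isUnit_det_gramR₀ L e dV hdV hdV0 dW hdW hdW0)
      (hermD_eq_map_gramD L e dV hdV dW hdW) (blkC_coe_leviDeltaLoc L e dV hdV dW hdW v a)
  -- STEP 4: the shift `½ ↦ ½ − 1` (★ σ-5 `levi_law_shift`)
  exact levi_law_shift (Fp L) L (IsCMField.complexConj L) (complexConj_imagUnit L) (imagUnit_ne_zero L) (imagUnit_mul_self L) v 2
    (gramR_isSymm L e dV hdV dW hdW) (hermD_eq_map_gramD L e dV hdV dW hdW) (fun w : PlacesOver L v => (χ ^ 3).localComponent w.1) _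
    (fun a : ↥(leviDeltaLoc L e dV hdV dW hdW v) => (a : UnitaryGroup.localPi L (IsCMField.complexConj L) (2 + 2) (hermD L e dV hdV dW hdW) v))
    (fun a => isSiegelDelta_of_mem_leviDeltaLoc L e dV hdV dW hdW v (complexConj_imagUnit L) (imagUnit_ne_zero L) (imagUnit_mul_self L) (gramR_isSymm L e dV hdV dW hdW)
      (hermD_eq_map_gramD L e dV hdV dW hdW) a.2)
    (1 / 2) (fun a => (cM a : ℂ)) hcM _ hr (fun a h => by rw [sectionB_eq, h1 a h, NNReal.smul_def, Complex.real_smul]) a h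


/-! ## §2 The unipotent invariance of `B := sectionB` -/

set_option maxHeartbeats 1600000 in -- as ★ I-4b `faceA4R_two_of_record`
omit [MeasurableSpace (Fin n' → v.adicCompletion (Fp L))] [BorelSpace (Fin n' → v.adicCompletion (Fp L))] in
include hdV' hW hPJ in
/-- **`N_Δ`-INVARIANCE ALONG THE PINS**: `B Φ (nΔ η · h) = B Φ h` — V8e's per-pin law `hN` (BY VALUE, the face's own socket term with `nΔ := nDeltaLoc`, `q := qHerm`,
`ψ := adeleAddCharAt`) and the isotropy of the integrated slice (★∕📤 σ-7a `hq0`). [cite: KudlaRallis1994, §1] [cite: Kudla1994, §3 Thm. 3.1] -/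
theorem sectionB_nDeltaLoc_mul
    (hN : ∀ (η : Fin 4 → v.adicCompletion (Fp L)) (Φ : SchwartzBruhat (Fin (n' + n') → v.adicCompletion (Fp L))) (x : Fin (n' + n') → v.adicCompletion (Fp L)),
      ((MpPsi.toRep (localSchrodingerDelta L e' dV hdV (tensorFrame L dW eW dV') (tensorFrame_real L dW hdW eW dV' hdV') v)
          (((mpTransportLoc L e' dV hdV (tensorFrame L dW eW dV') (tensorFrame_real L dW hdW eW dV' hdV') v Γ hΓ).toMonoidHom.comp
            (((finSplittings L e' dV hdV hdV0 (tensorFrame L dW eW dV') (tensorFrame_real L dW hdW eW dV' hdV') (tensorFrame_ne_zero L dW eW dV' hdW0 hdV'0) χ 𝔪 𝓕).s v).comp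
              (tensorEmbLoc L e dV hdV dW hdW eW e' dV' hdV' v))) (nDeltaLoc L e dV hdV dW hdW v hdV0 hdW0 η)) Φ :
          SchwartzBruhat (Fin (n' + n') → v.adicCompletion (Fp L))) : (Fin (n' + n') → v.adicCompletion (Fp L)) → ℂ) x =
        ((adeleAddCharAt (Fp L) v (η ⬝ᵥ qHerm L (complexConj_imagUnit L) (imagUnit_ne_zero L) e eW e' dV' v x) : Circle) : ℂ) *
          (Φ : (Fin (n' + n') → v.adicCompletion (Fp L)) → ℂ) x)
    (Φ : SchwartzBruhat (Fin (n' + n') → v.adicCompletion (Fp L))) (η : Fin 4 → v.adicCompletion (Fp L))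
    (h : UnitaryGroup.localPi L (IsCMField.complexConj L) (2 + 2) (hermD L e dV hdV dW hdW) v) :
    sectionB L e dV hdV hdV0 dW hdW hdW0 eW e' v P μX
        (fun u => MpPsi.toRep (localSchrodingerDelta L e' dV hdV (tensorFrame L dW eW dV') (tensorFrame_real L dW hdW eW dV' hdV') v)
          (((mpTransportLoc L e' dV hdV (tensorFrame L dW eW dV') (tensorFrame_real L dW hdW eW dV' hdV') v Γ hΓ).toMonoidHom.comp
            (((finSplittings L e' dV hdV hdV0 (tensorFrame L dW eW dV') (tensorFrame_real L dW hdW eW dV' hdV') (tensorFrame_ne_zero L dW eW dV' hdW0 hdV'0) χ 𝔪 𝓕).s v).comp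
              (tensorEmbLoc L e dV hdV dW hdW eW e' dV' hdV' v))) u)) Φ (nDeltaLoc L e dV hdV dW hdW v hdV0 hdW0 η * h) =
      sectionB L e dV hdV hdV0 dW hdW hdW0 eW e' v P μX
        (fun u => MpPsi.toRep (localSchrodingerDelta L e' dV hdV (tensorFrame L dW eW dV') (tensorFrame_real L dW hdW eW dV' hdV') v)
          (((mpTransportLoc L e' dV hdV (tensorFrame L dW eW dV') (tensorFrame_real L dW hdW eW dV' hdV') v Γ hΓ).toMonoidHom.comp
            (((finSplittings L e' dV hdV hdV0 (tensorFrame L dW eW dV') (tensorFrame_real L dW hdW eW dV' hdV') (tensorFrame_ne_zero L dW eW dV' hdW0 hdV'0) χ 𝔪 𝓕).s v).comp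
              (tensorEmbLoc L e dV hdV dW hdW eW e' dV' hdV' v))) u)) Φ h := by
  rw [sectionB_eq]
  exact krSection_unip_mul (thetaLoc L e dV hdV hdV0 dW hdW hdW0 eW e' v P) μX
    (fun u => MpPsi.toRep (localSchrodingerDelta L e' dV hdV (tensorFrame L dW eW dV') (tensorFrame_real L dW hdW eW dV' hdV') v)
          (((mpTransportLoc L e' dV hdV (tensorFrame L dW eW dV') (tensorFrame_real L dW hdW eW dV' hdV') v Γ hΓ).toMonoidHom.comp
            (((finSplittings L e' dV hdV hdV0 (tensorFrame L dW eW dV') (tensorFrame_real L dW hdW eW dV' hdV') (tensorFrame_ne_zero L dW eW dV' hdW0 hdV'0) χ 𝔪 𝓕).s v).comp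
              (tensorEmbLoc L e dV hdV dW hdW eW e' dV' hdV' v))) u))
    (fun g u Ψ => rep_comp_mul_apply (MpPsi.toRep (localSchrodingerDelta L e' dV hdV (tensorFrame L dW eW dV') (tensorFrame_real L dW hdW eW dV' hdV') v))
      ((mpTransportLoc L e' dV hdV (tensorFrame L dW eW dV') (tensorFrame_real L dW hdW eW dV' hdV') v Γ hΓ).toMonoidHom.comp
        (((finSplittings L e' dV hdV hdV0 (tensorFrame L dW eW dV') (tensorFrame_real L dW hdW eW dV' hdV') (tensorFrame_ne_zero L dW eW dV' hdW0 hdV'0) χ 𝔪 𝓕).s v).comp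
          (tensorEmbLoc L e dV hdV dW hdW eW e' dV' hdV' v))) g u Ψ)
    (nDeltaLoc L e dV hdV dW hdW v hdV0 hdW0) (qHerm L (complexConj_imagUnit L) (imagUnit_ne_zero L) e eW e' dV' v)
    (fun t => ((adeleAddCharAt (Fp L) v t : Circle) : ℂ)) (by rw [AddChar.map_zero_eq_one, Circle.coe_one]) hN
    (qHerm_thetaLoc_symm_slice_eq_zero L e dV hdV hdV0 dW hdW hdW0 eW e' dV' hdV' v P W hW hPJ) Φ η h

set_option maxHeartbeats 1600000 in -- as ★ I-4b `faceA4R_two_of_record`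
omit [MeasurableSpace (Fin n' → v.adicCompletion (Fp L))] [BorelSpace (Fin n' → v.adicCompletion (Fp L))] in
include hdV' hW hPJ in
/-- **`N_Δ`-INVARIANCE**: `B Φ (u · h) = B Φ h` for EVERY `u ∈ N_Δ(L⁺_v)` (the pins exhaust `N_Δ`, ★∕📤 σ-7a). [cite: KudlaRallis1994, §1] [cite: Kudla1994, §3 Thm. 3.1] -/
theorem sectionB_unip_mul
    (hN : ∀ (η : Fin 4 → v.adicCompletion (Fp L)) (Φ : SchwartzBruhat (Fin (n' + n') → v.adicCompletion (Fp L))) (x : Fin (n' + n') → v.adicCompletion (Fp L)),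
      ((MpPsi.toRep (localSchrodingerDelta L e' dV hdV (tensorFrame L dW eW dV') (tensorFrame_real L dW hdW eW dV' hdV') v)
          (((mpTransportLoc L e' dV hdV (tensorFrame L dW eW dV') (tensorFrame_real L dW hdW eW dV' hdV') v Γ hΓ).toMonoidHom.comp
            (((finSplittings L e' dV hdV hdV0 (tensorFrame L dW eW dV') (tensorFrame_real L dW hdW eW dV' hdV') (tensorFrame_ne_zero L dW eW dV' hdW0 hdV'0) χ 𝔪 𝓕).s v).comp
              (tensorEmbLoc L e dV hdV dW hdW eW e' dV' hdV' v))) (nDeltaLoc L e dV hdV dW hdW v hdV0 hdW0 η)) Φ :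
          SchwartzBruhat (Fin (n' + n') → v.adicCompletion (Fp L))) : (Fin (n' + n') → v.adicCompletion (Fp L)) → ℂ) x =
        ((adeleAddCharAt (Fp L) v (η ⬝ᵥ qHerm L (complexConj_imagUnit L) (imagUnit_ne_zero L) e eW e' dV' v x) : Circle) : ℂ) *
          (Φ : (Fin (n' + n') → v.adicCompletion (Fp L)) → ℂ) x)
    (Φ : SchwartzBruhat (Fin (n' + n') → v.adicCompletion (Fp L)))
    {u : UnitaryGroup.localPi L (IsCMField.complexConj L) (2 + 2) (hermD L e dV hdV dW hdW) v}
    (hu : u ∈ unipDeltaLocal (Fp L) L (IsCMField.complexConj L) v 2 (JD := hermD L e dV hdV dW hdW))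
    (h : UnitaryGroup.localPi L (IsCMField.complexConj L) (2 + 2) (hermD L e dV hdV dW hdW) v) :
    sectionB L e dV hdV hdV0 dW hdW hdW0 eW e' v P μX
        (fun u => MpPsi.toRep (localSchrodingerDelta L e' dV hdV (tensorFrame L dW eW dV') (tensorFrame_real L dW hdW eW dV' hdV') v)
          (((mpTransportLoc L e' dV hdV (tensorFrame L dW eW dV') (tensorFrame_real L dW hdW eW dV' hdV') v Γ hΓ).toMonoidHom.comp
            (((finSplittings L e' dV hdV hdV0 (tensorFrame L dW eW dV') (tensorFrame_real L dW hdW eW dV' hdV') (tensorFrame_ne_zero L dW eW dV' hdW0 hdV'0) χ 𝔪 𝓕).s v).comp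
              (tensorEmbLoc L e dV hdV dW hdW eW e' dV' hdV' v))) u)) Φ (u * h) =
      sectionB L e dV hdV hdV0 dW hdW hdW0 eW e' v P μX
        (fun u => MpPsi.toRep (localSchrodingerDelta L e' dV hdV (tensorFrame L dW eW dV') (tensorFrame_real L dW hdW eW dV' hdV') v)
          (((mpTransportLoc L e' dV hdV (tensorFrame L dW eW dV') (tensorFrame_real L dW hdW eW dV' hdV') v Γ hΓ).toMonoidHom.comp
            (((finSplittings L e' dV hdV hdV0 (tensorFrame L dW eW dV') (tensorFrame_real L dW hdW eW dV' hdV') (tensorFrame_ne_zero L dW eW dV' hdW0 hdV'0) χ 𝔪 𝓕).s v).comp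
              (tensorEmbLoc L e dV hdV dW hdW eW e' dV' hdV' v))) u)) Φ h := by
  obtain ⟨η, rfl⟩ := exists_nDeltaLoc_eq_of_mem_unipDeltaLocal L e dV hdV hdV0 dW hdW hdW0 v hu
  exact sectionB_nDeltaLoc_mul L e dV hdV hdV0 dW hdW hdW0 eW e' dV' hdV' hdV'0 χ 𝔪 𝓕 v Γ hΓ P W hW hPJ μX hN Φ η h

/-! ## §3 The socket `hSiegS` -/

set_option maxHeartbeats 1600000 in -- as ★ I-4b `faceA4R_two_of_record`
include hdV' hdV'0 hM₂ μ hΓ0 hs₀ hW hPJ in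
/-- **`hSiegS` FOR `B := sectionB`: THE SMALL-SIDE SECTION IS A SIEGEL SECTION OF `I_v(−½, χ_v)`**, `χ_v := ((χ³)_w)_w` — Levi law (§1), `N_Δ`-invariance (§2), the fold
★ σ-5 `isLocalSiegelSection_of_levi_unip` along `P_Δ = M_Δ · N_Δ` (★ K2Liu-p09 `exists_leviDeltaLoc_mul_unipDeltaLocal`).
[cite: HarrisKudlaSweet1996, §1 (1.11), (1.15)] [cite: KudlaRallis1994, §1] [cite: Kudla1994, §3 Thm. 3.1] -/
theorem isLocalSiegelSection_sectionB
    (hN : ∀ (η : Fin 4 → v.adicCompletion (Fp L)) (Φ : SchwartzBruhat (Fin (n' + n') → v.adicCompletion (Fp L))) (x : Fin (n' + n') → v.adicCompletion (Fp L)),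
      ((MpPsi.toRep (localSchrodingerDelta L e' dV hdV (tensorFrame L dW eW dV') (tensorFrame_real L dW hdW eW dV' hdV') v)
          (((mpTransportLoc L e' dV hdV (tensorFrame L dW eW dV') (tensorFrame_real L dW hdW eW dV' hdV') v Γ hΓ).toMonoidHom.comp
            (((finSplittings L e' dV hdV hdV0 (tensorFrame L dW eW dV') (tensorFrame_real L dW hdW eW dV' hdV') (tensorFrame_ne_zero L dW eW dV' hdW0 hdV'0) χ 𝔪 𝓕).s v).comp
              (tensorEmbLoc L e dV hdV dW hdW eW e' dV' hdV' v))) (nDeltaLoc L e dV hdV dW hdW v hdV0 hdW0 η)) Φ :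
          SchwartzBruhat (Fin (n' + n') → v.adicCompletion (Fp L))) : (Fin (n' + n') → v.adicCompletion (Fp L)) → ℂ) x =
        ((adeleAddCharAt (Fp L) v (η ⬝ᵥ qHerm L (complexConj_imagUnit L) (imagUnit_ne_zero L) e eW e' dV' v x) : Circle) : ℂ) *
          (Φ : (Fin (n' + n') → v.adicCompletion (Fp L)) → ℂ) x)
    (Φ : SchwartzBruhat (Fin (n' + n') → v.adicCompletion (Fp L))) :
    IsLocalSiegelSection (Fp L) L (IsCMField.complexConj L) (complexConj_imagUnit L) (imagUnit_ne_zero L) (imagUnit_mul_self L) v 2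
      (gramR_isSymm L e dV hdV dW hdW) (hermD_eq_map_gramD L e dV hdV dW hdW) (fun w : PlacesOver L v => (χ ^ 3).localComponent w.1) (-(1 / 2))
      (sectionB L e dV hdV hdV0 dW hdW hdW0 eW e' v P μX
        (fun u => MpPsi.toRep (localSchrodingerDelta L e' dV hdV (tensorFrame L dW eW dV') (tensorFrame_real L dW hdW eW dV' hdV') v)
          (((mpTransportLoc L e' dV hdV (tensorFrame L dW eW dV') (tensorFrame_real L dW hdW eW dV' hdV') v Γ hΓ).toMonoidHom.comp
            (((finSplittings L e' dV hdV hdV0 (tensorFrame L dW eW dV') (tensorFrame_real L dW hdW eW dV' hdV') (tensorFrame_ne_zero L dW eW dV' hdW0 hdV'0) χ 𝔪 𝓕).s v).comp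
              (tensorEmbLoc L e dV hdV dW hdW eW e' dV' hdV' v))) u)) Φ) := by
  refine isLocalSiegelSection_of_levi_unip (Fp L) L (IsCMField.complexConj L) (complexConj_imagUnit L) (imagUnit_ne_zero L) (imagUnit_mul_self L) v 2
    (gramR_isSymm L e dV hdV dW hdW) (hermD_eq_map_gramD L e dV hdV dW hdW) _ _ _ (leviDeltaLoc L e dV hdV dW hdW v)
    (fun m hm => isSiegelDelta_of_mem_leviDeltaLoc L e dV hdV dW hdW v (complexConj_imagUnit L) (imagUnit_ne_zero L) (imagUnit_mul_self L)
      (gramR_isSymm L e dV hdV dW hdW) (hermD_eq_map_gramD L e dV hdV dW hdW) hm)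
    (fun m hm h => ?_) (fun u hu h => sectionB_unip_mul L e dV hdV hdV0 dW hdW hdW0 eW e' dV' hdV' hdV'0 χ 𝔪 𝓕 v Γ hΓ P W hW hPJ μX hN Φ hu h)
    (fun p hp => exists_leviDeltaLoc_mul_unipDeltaLocal L (complexConj_imagUnit L) (imagUnit_ne_zero L) (imagUnit_mul_self L) e dV hdV dW hdW v
      (gramR_isSymm L e dV hdV dW hdW) (hermD_eq_map_gramD L e dV hdV dW hdW) hp)
  have hs : (-(1 / 2) : ℂ) = 1 / 2 - 1 := by norm_num
  rw [hs]
  exact sectionB_leviDeltaLoc_mul L e dV hdV hdV0 dW hdW hdW0 eW e' dV' hdV' hdV'0 hM₂ χ 𝔪 𝓕 v μ Γ hΓ hΓ0 hs₀ P μX ⟨m, hm⟩ Φ h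

set_option maxHeartbeats 1600000 in -- as ★ I-4b `faceA4R_two_of_record`
include hdV' hdV'0 hM₂ μ hΓ0 hs₀ hW hPJ in
/-- **`hSiegS` IN THE FACE'S CURRENCY `χ′_v := conjInvChar c v χ_v`** (★ σ-1), under `hχs : IsSplittingChar L 1 χ` (★ σ-6 `conjInvChar_localComponent_pow_eq`: `χ′_v = χ_v`).
[cite: HarrisKudlaSweet1996, §1 (1.15)] [cite: Liu2021, App. B §B.3] -/
theorem isLocalSiegelSection_sectionB_conjInvChar (hχs : IsSplittingChar L 1 χ)
    (hN : ∀ (η : Fin 4 → v.adicCompletion (Fp L)) (Φ : SchwartzBruhat (Fin (n' + n') → v.adicCompletion (Fp L))) (x : Fin (n' + n') → v.adicCompletion (Fp L)),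
      ((MpPsi.toRep (localSchrodingerDelta L e' dV hdV (tensorFrame L dW eW dV') (tensorFrame_real L dW hdW eW dV' hdV') v)
          (((mpTransportLoc L e' dV hdV (tensorFrame L dW eW dV') (tensorFrame_real L dW hdW eW dV' hdV') v Γ hΓ).toMonoidHom.comp
            (((finSplittings L e' dV hdV hdV0 (tensorFrame L dW eW dV') (tensorFrame_real L dW hdW eW dV' hdV') (tensorFrame_ne_zero L dW eW dV' hdW0 hdV'0) χ 𝔪 𝓕).s v).comp
              (tensorEmbLoc L e dV hdV dW hdW eW e' dV' hdV' v))) (nDeltaLoc L e dV hdV dW hdW v hdV0 hdW0 η)) Φ :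
          SchwartzBruhat (Fin (n' + n') → v.adicCompletion (Fp L))) : (Fin (n' + n') → v.adicCompletion (Fp L)) → ℂ) x =
        ((adeleAddCharAt (Fp L) v (η ⬝ᵥ qHerm L (complexConj_imagUnit L) (imagUnit_ne_zero L) e eW e' dV' v x) : Circle) : ℂ) *
          (Φ : (Fin (n' + n') → v.adicCompletion (Fp L)) → ℂ) x)
    (Φ : SchwartzBruhat (Fin (n' + n') → v.adicCompletion (Fp L))) :
    IsLocalSiegelSection (Fp L) L (IsCMField.complexConj L) (complexConj_imagUnit L) (imagUnit_ne_zero L) (imagUnit_mul_self L) v 2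
      (gramR_isSymm L e dV hdV dW hdW) (hermD_eq_map_gramD L e dV hdV dW hdW)
      (conjInvChar L (IsCMField.complexConj L) v fun w : PlacesOver L v => (χ ^ 3).localComponent w.1) (-(1 / 2))
      (sectionB L e dV hdV hdV0 dW hdW hdW0 eW e' v P μX
        (fun u => MpPsi.toRep (localSchrodingerDelta L e' dV hdV (tensorFrame L dW eW dV') (tensorFrame_real L dW hdW eW dV' hdV') v)
          (((mpTransportLoc L e' dV hdV (tensorFrame L dW eW dV') (tensorFrame_real L dW hdW eW dV' hdV') v Γ hΓ).toMonoidHom.comp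
            (((finSplittings L e' dV hdV hdV0 (tensorFrame L dW eW dV') (tensorFrame_real L dW hdW eW dV' hdV') (tensorFrame_ne_zero L dW eW dV' hdW0 hdV'0) χ 𝔪 𝓕).s v).comp
              (tensorEmbLoc L e dV hdV dW hdW eW e' dV' hdV' v))) u)) Φ) := by
  rw [conjInvChar_localComponent_pow_eq L hχs 3 v]
  exact isLocalSiegelSection_sectionB L e dV hdV hdV0 dW hdW hdW0 eW e' dV' hdV' hdV'0 hM₂ χ 𝔪 𝓕 v μ Γ hΓ hΓ0 hs₀ P W hW hPJ μX hN Φ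

end Summit.HodgeConjecture.HodgeConjecture.Cruxes.HLiu418.K2LiuA7ValueSocketSmallSide

end
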